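import Literature.Dynamics.TopologicalDynamics.ToralAutomorphismsStructuralStability
import Literature.AlgebraicGeometry.HodgeTheory.AbelianVarietyHyperbolicEndomorphismsShadowing
import HarnessLib

/-!
# Structural stability of the hyperbolic automorphisms of complex tori and complex abelian varieties
# (Katok–Hasselblatt, Theorem 2.6.3 with Exercise 2.6.1, read on `A(ℂ)` in flat coordinates)

Lane `lit-hodgefound`, row g24-#3 FILE 2 (prover seat `lit-hodgefound-p31`): the lane file of
`Literature/Dynamics/TopologicalDynamics/ToralAutomorphismsStructuralStability.lean` (`C¹` strong structural stability
of the hyperbolic affine automorphisms `x ↦ T_M x + a`, `NM = 1`, of `(ℝ/ℤ)^ι`: every perturbation `T + E mod ℤ^ι` with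
`E : (ℝ/ℤ)^ι → ℝ^ι` Lipschitz-small and sup-small is topologically conjugate to `T` by a homeomorphism close to the
identity; transported along conjugacies `φ₀ : (ℝ/ℤ)^ι ≃ Y`), read on complex tori `X = E/Φ(ℤ^ι)` (`ComplexTorus Φ`, the
affine automorphisms `t ↦ ρ(M) t + c`) and on the complex points `A(ℂ)` of a complex abelian variety uniformised by a
group homeomorphism `φ : X ≃ A(ℂ)` (✔ `complexAbelianVariety_torusUniformised`): the perturbations are those which are
`C¹`-small in the FLAT coordinates of the uniformisation — `g(P) = f(ℂ)(P) · φ(E(φ⁻¹P) mod Λ)` with `E` Lipschitz-small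
and bounded —, the conjugacy is a homeomorphism of `A(ℂ)` uniformly close to the identity for any uniform structure
inducing the complex topology.  Sequel of `AbelianVarietyHyperbolicAutomorphismsTopologicalStability.lean`
(✔ g24-#2: Theorem 2.6.1 on `A(ℂ)`).

## The printed statements

A. Katok, B. Hasselblatt, *Introduction to the Modern Theory of Dynamical Systems* (CUP 1995; galaxy
`panama:410555923824727` chars 399000–417000), §2.6 **Proposition 2.6.2** («Any `C¹` map `g` sufficiently close to
`F_L` in the `C¹` topology is a factor of `F_L`»), **Theorem 2.6.3** («Any hyperbolic linear automorphism of the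
two-torus is `C¹` strongly structurally stable») and **Exercise 2.6.1** («… can be generalized to any hyperbolic linear
automorphism of the `m`-torus for `m ≥ 2`»).  On `A(ℂ)`: an automorphism `f` of the abelian variety `A` is, in every
uniformisation, a linear automorphism `ρ(M)` of the torus, `M = ρ_r(f) ∈ GL_ι(ℤ)`, whose eigenvalues are those of
`f(ℂ)^*` on `H¹(A(ℂ); ℚ)` [cite: Lange2023AbelianVarietiesComplex, §1.1.2 Prop. 1.1.6 (PDF p. 19)].

## What is formalised (theorems only; no definition, no named fact)

* §1 complex tori: **`ComplexTorus.structuralStability_mapMatrix_add_of_hyperbolic`** (the affine automorphisms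
  `t ↦ ρ(M) t + c`, `NM = 1`, no eigenvalue of `M` of modulus `1`: for every entourage `V` of a compatible uniformity
  there is `δ > 0` such that every perturbation `t ↦ ρ(M) t + c + E(t) mod Λ` with `E` `Λ'`-Lipschitz in the flat
  coordinates, `Λ' < Λ₀`, `‖E‖ ≤ δ`, is conjugate to `t ↦ ρ(M) t + c` by a homeomorphism `h` with `(h t, t) ∈ V`),
  `ComplexTorus.structuralStability_mapMatrix_of_hyperbolic`.
* §2 complex abelian varieties: `AbelianVariety.structuralStability_of_semiconj_of_hyperbolic` (through a group
  homeomorphism `φ : X ≃ A(ℂ)` conjugating `f(ℂ)` to `ρ(M)`, `NM = 1`) and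
  **`AbelianVariety.structuralStability_of_isIso_of_hyperbolic`** (THEOREM 2.6.3 ON `A(ℂ)`: `f` an automorphism with no
  eigenvalue of `f(ℂ)^*` on `H¹(A(ℂ); ℚ)` of modulus `1`, `φ` a uniformisation: for every entourage `V` there is `δ > 0`
  such that every `g = f(ℂ) · φ(E ∘ φ⁻¹ mod Λ)` with `E` `Λ'`-Lipschitz, `Λ' < Λ₀`, `‖E‖ ≤ δ` is TOPOLOGICALLY CONJUGATE to
  `f(ℂ)` — `g ∘ h = h ∘ f(ℂ)` — by a homeomorphism `h` of `A(ℂ)` with `(h P, P) ∈ V` for all `P`).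

## References

* [KatokHasselblatt1995] A. Katok, B. Hasselblatt, *Introduction to the Modern Theory of Dynamical Systems*, CUP
  (1995), §2.6 Proposition 2.6.2, Theorem 2.6.3, Exercise 2.6.1 (galaxy panama:410555923824727 chars 399000–417000).
* [Walters1982] P. Walters, *An Introduction to Ergodic Theory*, GTM 79 (1982), §5.6 Remarks (i), (iii) (held text
  chunk p0150) — independence of the metric, conjugacy invariance.
* [Lange2023AbelianVarietiesComplex] H. Lange, *Abelian Varieties over the Complex Numbers*, Springer (2023), §1.1.2
  Proposition 1.1.6, §1.1.3 Lemma 1.1.17 (PDF pp. 19, 23).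
-/

noncomputable section

open Set Function Filter Topology
open CategoryTheory
open Literature.Dynamics.TopologicalDynamics
open Literature.AlgebraicTopology.SingularHomology Literature.NumberTheory.LFunctions
open Literature.NumberTheory.Transcendental (IsAnalytification)
open Literature.AlgebraicGeometry.Motives (ComplexPoints AbelianVariety AlgPoints specOver)
open scoped Uniformity NNReal

/-! ### §1 Complex tori `X = E/Φ(ℤ^ι)` -/

namespace Literature.Geometry.Kaehler.ComplexTorus

variable {ι : Type*} [Fintype ι] [DecidableEq ι] {E : Type*} [NormedAddCommGroup E] [NormedSpace ℂ E]
  (Φ : (ι → ℝ) ≃L[ℝ] E)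

/-- **Structural stability of the hyperbolic affine automorphisms `t ↦ ρ(M) t + c` of a complex torus** (`NM = 1`, no
complex eigenvalue of `M` of modulus `1`; every uniform structure `u` on `X = E/Φ(ℤ^ι)` inducing its topology): there
is `Λ₀ > 0` and for every entourage `V` a `δ > 0` such that every perturbation `g(t) = ρ(M) t + c + E(t) mod Λ` with `E`
`Λ'`-Lipschitz in the flat coordinates of `X` (`Λ' < Λ₀`) and `‖E‖ ≤ δ` is topologically conjugate to `S(t) = ρ(M) t + c`:
a homeomorphism `h` of `X` with `g ∘ h = h ∘ S` and `(h t, t) ∈ V` for all `t`.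
[cite: KatokHasselblatt1995, §2.6 Theorem 2.6.3 and Exercise 2.6.1 (galaxy panama:410555923824727 chars 399000–417000)]
[cite: Walters1982, §5.6 Remarks (i), (iii) (held text chunk p0150)] -/
theorem structuralStability_mapMatrix_add_of_hyperbolic (u : UniformSpace (ComplexTorus Φ))
    (hu : u.toTopologicalSpace = ComplexTorus.instTopologicalSpace Φ) (M N : Matrix ι ι ℤ) (hNM : N * M = 1)
    (hM : ∀ μ ∈ (M.map (Int.castRingHom ℂ)).charpoly.roots, ‖μ‖ ≠ 1) (c : ComplexTorus Φ) :
    ∃ Λ₀ : ℝ, 0 < Λ₀ ∧ ∀ V ∈ 𝓤[u], ∃ δ : ℝ, 0 < δ ∧ ∀ (E : UnitAddTorus ι → ι → ℝ) (Λ : ℝ≥0),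
      LipschitzWith Λ E → (Λ : ℝ) < Λ₀ → (∀ x, ‖E x‖ ≤ δ) →
      ∃ h : ComplexTorus Φ ≃ₜ ComplexTorus Φ,
        (∀ t, mapMatrix Φ Φ M (h t) + c + (ComplexTorus.toRealTorus Φ).symm
            (fun i ↦ ((E (ComplexTorus.toRealTorus Φ (h t)) i : ℝ) : UnitAddCircle)) =
          h (mapMatrix Φ Φ M t + c)) ∧ ∀ t, (h t, t) ∈ V :=
  ToralStructuralStability.structuralStability_of_semiconj (Y := ComplexTorus Φ) M N hNM
    (ComplexTorus.toRealTorus Φ c) (T := fun x ↦ (fun i ↦ ∑ j, M i j • x j) + ComplexTorus.toRealTorus Φ c)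
    (fun _ ↦ rfl) hM u hu (ComplexTorus.toRealTorus Φ).symm (S := fun t ↦ mapMatrix Φ Φ M t + c) fun _ ↦ rfl

/-- **Structural stability of the hyperbolic automorphisms `ρ(M)` of a complex torus** (`NM = 1`; every compatible
uniformity; perturbations `ρ(M) + E mod Λ` with `E` Lipschitz-small in the flat coordinates).
[cite: KatokHasselblatt1995, §2.6 Theorem 2.6.3 and Exercise 2.6.1 (galaxy panama:410555923824727 chars 399000–417000)] -/
theorem structuralStability_mapMatrix_of_hyperbolic (u : UniformSpace (ComplexTorus Φ))
    (hu : u.toTopologicalSpace = ComplexTorus.instTopologicalSpace Φ) (M N : Matrix ι ι ℤ) (hNM : N * M = 1)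
    (hM : ∀ μ ∈ (M.map (Int.castRingHom ℂ)).charpoly.roots, ‖μ‖ ≠ 1) :
    ∃ Λ₀ : ℝ, 0 < Λ₀ ∧ ∀ V ∈ 𝓤[u], ∃ δ : ℝ, 0 < δ ∧ ∀ (E : UnitAddTorus ι → ι → ℝ) (Λ : ℝ≥0),
      LipschitzWith Λ E → (Λ : ℝ) < Λ₀ → (∀ x, ‖E x‖ ≤ δ) →
      ∃ h : ComplexTorus Φ ≃ₜ ComplexTorus Φ,
        (∀ t, mapMatrix Φ Φ M (h t) + (ComplexTorus.toRealTorus Φ).symm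
            (fun i ↦ ((E (ComplexTorus.toRealTorus Φ (h t)) i : ℝ) : UnitAddCircle)) = h (mapMatrix Φ Φ M t)) ∧
        ∀ t, (h t, t) ∈ V :=
  ToralStructuralStability.structuralStability_mapMatrix_of_semiconj (Y := ComplexTorus Φ) M N hNM hM u hu
    (ComplexTorus.toRealTorus Φ).symm (T := fun x ↦ fun i ↦ ∑ j, M i j • x j) (fun _ ↦ rfl)
    (S := mapMatrix Φ Φ M) fun _ ↦ rfl

end Literature.Geometry.Kaehler.ComplexTorus

/-! ### §2 Complex abelian varieties -/

namespace Literature.AlgebraicGeometry.HodgeTheory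

open Literature.Geometry.Kaehler

section StructuralStability

variable (A : AbelianVariety ℂ)

/-- **Through a uniformisation:** if a GROUP homeomorphism `φ : E/Φ(ℤ^ι) ≃ A(ℂ)` conjugates `f(ℂ)` to `ρ(M)` with
`NM = 1` and no complex eigenvalue of `M` of modulus `1`, then for every uniform structure on `A(ℂ)` inducing its
topology and every entourage `V` there is `δ > 0` such that every perturbation `g(P) = f(ℂ)(P) · φ(E(φ⁻¹ P) mod Λ)`
(`E` `Λ'`-Lipschitz in the flat coordinates, `Λ' < Λ₀`, `‖E‖ ≤ δ`) is topologically conjugate to `f(ℂ)` by a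
homeomorphism `h` of `A(ℂ)`, `g ∘ h = h ∘ f(ℂ)`, with `(h P, P) ∈ V`.
[cite: KatokHasselblatt1995, §2.6 Theorem 2.6.3 and Exercise 2.6.1 (galaxy panama:410555923824727 chars 399000–417000)]
[cite: Lange2023AbelianVarietiesComplex, §1.1.2 Prop. 1.1.6 (PDF p. 19)] -/
theorem AbelianVariety.structuralStability_of_semiconj_of_hyperbolic (u : UniformSpace (A.Points ℂ))
    (hu : u.toTopologicalSpace = (inferInstance : TopologicalSpace (A.Points ℂ))) {ι : Type*} [Fintype ι]
    [DecidableEq ι] {E : Type*} [NormedAddCommGroup E] [NormedSpace ℂ E] {Φ : (ι → ℝ) ≃L[ℝ] E}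
    (φ : ComplexTorus Φ ≃ₜ A.Points ℂ) (hadd : ∀ x y, φ (x + y) = φ x * φ y) (f : A ⟶ A) (M N : Matrix ι ι ℤ)
    (hNM : N * M = 1)
    (hM : ∀ t, φ (ComplexTorus.mapMatrix Φ Φ M t) = AlgPoints.mapContinuous (L := ℂ) f.hom.hom.hom (φ t))
    (hroots : ∀ μ ∈ (M.map (Int.castRingHom ℂ)).charpoly.roots, ‖μ‖ ≠ 1) :
    ∃ Λ₀ : ℝ, 0 < Λ₀ ∧ ∀ V ∈ 𝓤[u], ∃ δ : ℝ, 0 < δ ∧ ∀ (E' : UnitAddTorus ι → ι → ℝ) (Λ : ℝ≥0),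
      LipschitzWith Λ E' → (Λ : ℝ) < Λ₀ → (∀ x, ‖E' x‖ ≤ δ) →
      ∃ h : A.Points ℂ ≃ₜ A.Points ℂ,
        (∀ P, AlgPoints.mapContinuous (L := ℂ) f.hom.hom.hom (h P) *
            φ ((ComplexTorus.toRealTorus Φ).symm fun i ↦
              ((E' (ComplexTorus.toRealTorus Φ (φ.symm (h P))) i : ℝ) : UnitAddCircle)) =
          h (AlgPoints.mapContinuous (L := ℂ) f.hom.hom.hom P)) ∧ ∀ P, (h P, P) ∈ V := by
  obtain ⟨Λ₀, hΛ₀, hst⟩ := ToralStructuralStability.structuralStability_mapMatrix_of_semiconj (Y := A.Points ℂ) M N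
    hNM hroots u hu ((ComplexTorus.toRealTorus Φ).symm.trans φ) (T := fun x ↦ fun i ↦ ∑ j, M i j • x j)
    (fun _ ↦ rfl) (S := AlgPoints.mapContinuous (L := ℂ) f.hom.hom.hom) fun t ↦ hM t
  refine ⟨Λ₀, hΛ₀, fun V hV ↦ ?_⟩
  obtain ⟨δ, hδ, hδ'⟩ := hst V hV
  refine ⟨δ, hδ, fun E' Λ hE' hΛ hEδ ↦ ?_⟩
  obtain ⟨h, hconj, hV'⟩ := hδ' E' Λ hE' hΛ hEδ
  refine ⟨h, fun P ↦ ?_, hV'⟩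
  calc AlgPoints.mapContinuous (L := ℂ) f.hom.hom.hom (h P) *
        φ ((ComplexTorus.toRealTorus Φ).symm fun i ↦
          ((E' (ComplexTorus.toRealTorus Φ (φ.symm (h P))) i : ℝ) : UnitAddCircle))
      = φ (ComplexTorus.mapMatrix Φ Φ M (φ.symm (h P))) *
          φ ((ComplexTorus.toRealTorus Φ).symm fun i ↦
            ((E' (ComplexTorus.toRealTorus Φ (φ.symm (h P))) i : ℝ) : UnitAddCircle)) := by
        rw [hM, φ.apply_symm_apply]
    _ = φ (ComplexTorus.mapMatrix Φ Φ M (φ.symm (h P)) + (ComplexTorus.toRealTorus Φ).symm fun i ↦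
            ((E' (ComplexTorus.toRealTorus Φ (φ.symm (h P))) i : ℝ) : UnitAddCircle)) := (hadd _ _).symm
    _ = h (AlgPoints.mapContinuous (L := ℂ) f.hom.hom.hom P) := hconj P

/-- `f⁻¹(ℂ) ∘ f(ℂ) = id` for an automorphism `f`. [folklore] -/
private theorem leftInverse_mapContinuous_inv (f : A ⟶ A) [IsIso f] :
    LeftInverse (AlgPoints.mapContinuous (L := ℂ) (inv f).hom.hom.hom)
      (AlgPoints.mapContinuous (L := ℂ) f.hom.hom.hom) := by
  intro P
  have hid : f.hom.hom.hom ≫ (inv f).hom.hom.hom = 𝟙 A.X := by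
    change (f ≫ inv f).hom.hom.hom = (𝟙 A : A ⟶ A).hom.hom.hom
    rw [IsIso.hom_inv_id]
  rw [AlgPoints.mapContinuous_apply, AlgPoints.mapContinuous_apply, ← AlgPoints.map_comp_apply, hid,
    AlgPoints.map_id_apply]

variable (f : A ⟶ A) {ι : Type} [Fintype ι] [DecidableEq ι] {E : Type} [NormedAddCommGroup E] [NormedSpace ℂ E]
  [FiniteDimensional ℂ E] {Φ : (ι → ℝ) ≃L[ℝ] E} {φ : ComplexTorus Φ → ComplexPoints A.X}
  (hφ : IsAnalytification E A.X A.dim φ) (hadd : ∀ x y, φ (x + y) = φ x * φ y)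

include hφ hadd in
/-- **Theorem 2.6.3 (`C¹` strong structural stability) for the hyperbolic automorphisms of a complex abelian
variety, in flat coordinates.**  Let `A` be a complex abelian variety, `φ : X = E/Φ(ℤ^ι) ≃ A(ℂ)` a uniformisation by a
complex torus which is a group homomorphism (✔ `complexAbelianVariety_torusUniformised`), and `f` an AUTOMORPHISM of
`A` such that `f(ℂ)^*` has no eigenvalue of modulus `1` on `H¹(A(ℂ); ℚ)` (e.g. `(P, Q) ↦ (P²Q, PQ)` on `B × B`).  There
is `Λ₀ > 0`, and for every uniform structure `u` on `A(ℂ)` inducing its complex topology and every entourage `V ∈ 𝓤`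
a `δ > 0`, such that every perturbation of `f(ℂ)` which is `C¹`-small in the flat coordinates —
`g(P) = f(ℂ)(P) · φ(E′(φ⁻¹P) mod Λ)` with `E′ : (ℝ/ℤ)^ι → ℝ^ι` `Λ′`-Lipschitz, `Λ′ < Λ₀`, and `‖E′‖ ≤ δ` — is
TOPOLOGICALLY CONJUGATE to `f(ℂ)`: there is a homeomorphism `h` of `A(ℂ)` with `g ∘ h = h ∘ f(ℂ)` and `(h(P), P) ∈ V`
for all `P` (Theorem 2.6.3 / Exercise 2.6.1 for `ρ(ρ_r(f)) ∈ GL_ι(ℤ)`, transported along `φ`).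
[cite: KatokHasselblatt1995, §2.6 Proposition 2.6.2, Theorem 2.6.3 and Exercise 2.6.1 (galaxy panama:410555923824727 chars 399000–417000)]
[cite: Lange2023AbelianVarietiesComplex, §1.1.2 Prop. 1.1.6 and §1.1.3 Lemma 1.1.17 (PDF pp. 19, 23)] -/
theorem AbelianVariety.structuralStability_of_isIso_of_hyperbolic [IsIso f] (u : UniformSpace (A.Points ℂ))
    (hu : u.toTopologicalSpace = (inferInstance : TopologicalSpace (A.Points ℂ)))
    (h : ∀ α ∈ FrobeniusCharpoly.eigenvalues ℂ
      (singularCohomology.map ℚ ℚ (AlgPoints.mapContinuous (L := ℂ) f.hom.hom.hom) 1).hom, ‖α‖ ≠ 1) :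
    ∃ Λ₀ : ℝ, 0 < Λ₀ ∧ ∀ V ∈ 𝓤[u], ∃ δ : ℝ, 0 < δ ∧ ∀ (E' : UnitAddTorus ι → ι → ℝ) (Λ : ℝ≥0),
      LipschitzWith Λ E' → (Λ : ℝ) < Λ₀ → (∀ x, ‖E' x‖ ≤ δ) →
      ∃ hh : A.Points ℂ ≃ₜ A.Points ℂ,
        (∀ P, AlgPoints.mapContinuous (L := ℂ) f.hom.hom.hom (hh P) *
            φ ((ComplexTorus.toRealTorus Φ).symm fun i ↦
              ((E' (ComplexTorus.toRealTorus Φ (hφ.homeomorph.symm (hh P))) i : ℝ) : UnitAddCircle)) =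
          hh (AlgPoints.mapContinuous (L := ℂ) f.hom.hom.hom P)) ∧ ∀ P, (hh P, P) ∈ V := by
  obtain ⟨M, hM⟩ := exists_mapMatrix_comp_eq_of_hom Φ Φ ⟨φ, hφ.isHomeomorph.continuous⟩ hφ hadd
    ⟨φ, hφ.isHomeomorph.continuous⟩ hφ hadd f
  obtain ⟨N, hN⟩ := exists_mapMatrix_comp_eq_of_hom Φ Φ ⟨φ, hφ.isHomeomorph.continuous⟩ hφ hadd
    ⟨φ, hφ.isHomeomorph.continuous⟩ hφ hadd (inv f)
  have hM' : ∀ t, φ (ComplexTorus.mapMatrix Φ Φ M t) = AlgPoints.mapContinuous (L := ℂ) f.hom.hom.hom (φ t) :=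
    fun t ↦ hM t
  have hN' : ∀ t, φ (ComplexTorus.mapMatrix Φ Φ N t) =
      AlgPoints.mapContinuous (L := ℂ) (inv f).hom.hom.hom (φ t) := fun t ↦ hN t
  -- `N M = 1`: `ρ(N) ρ(M)` is conjugate to `f⁻¹(ℂ) f(ℂ) = id`
  have hNM : N * M = 1 := by
    refine ComplexTorus.mapMatrix_injective (Φ := Φ) (Φ' := Φ) (funext fun t ↦ ?_)
    rw [ComplexTorus.mapMatrix_one, ← ComplexTorus.mapMatrix_mapMatrix (Φ' := Φ) N M t]
    apply hφ.isHomeomorph.injective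
    rw [hN', hM']
    exact leftInverse_mapContinuous_inv A f (φ t)
  rw [eigenvalues_singularCohomology_map_one_eq_roots_charpoly A f hφ hM'] at h
  have hadd' : ∀ x y, hφ.homeomorph (x + y) = hφ.homeomorph x * hφ.homeomorph y := fun x y ↦ by
    rw [IsAnalytification.coe_homeomorph]; exact hadd x y
  have h' := AbelianVariety.structuralStability_of_semiconj_of_hyperbolic A u hu hφ.homeomorph hadd' f M N hNM
    (fun t ↦ by rw [IsAnalytification.coe_homeomorph]; exact hM' t) h
  simp only [IsAnalytification.coe_homeomorph] at h'
  exact h'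

end StructuralStability

end Literature.AlgebraicGeometry.HodgeTheory
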